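import Summits.QuantumFields.QCD.Theorems.QuarksAsStableActionCriticalLineDiamagnetismCellFreeKron

/-!
# Symmetries of the free 2D frequency operator and of its inverse (B6 infrastructure, 2/4)

Crux `Summit.QuantumFields.QCD.Theses.QuarksAsStableAction.CriticalLineDiamagnetism` (item stmt-QuantumFields-9734,
sub-problem `Summits/QuantumFields/QCD/Statement.lean`), line `Sketch`, Route B step B6: infrastructure for the registered
cell sub-stub `cellFirstOrder` of `stub_heavyFrequencyGain` (plan `S4-PLAN.md` §B6 of the line lead; vocabulary
`CellFO.*` of `…CellFirstOrderDefs`).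

Covariance of an invertible matrix transfers to its inverse; the free operator is covariant under the two TWISTED
translations (translation by one site composed with the sign flip on the column/row `0`, which moves the antiperiodic seam
back), under colour rotations and colour sign flips (it is colour-trivial), and it is `γ₅`-hermitian
(`Dᴴ = Γ₅ D Γ₅`, `Γ₅ = 1 ⊗ 1 ⊗ γ₅`); hence so is the free propagator `G = D⁻¹`.
-/

noncomputable section

open scoped BigOperators Matrix ComplexConjugate Kronecker Matrix.Norms.L2Operator
open Matrix Literature.MathematicalPhysics.QuantumLattice
open Summit.QuantumFields.QCD.Cruxes.CriticalLineDiamagnetism.ChessboardCellGain.FrequencyDiamagnetism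
open Summit.QuantumFields.QCD.Cruxes.CriticalLineDiamagnetism.ChessboardCellGain.CellKappa

namespace Summit.QuantumFields.QCD.Cruxes.CriticalLineDiamagnetism.ChessboardCellGain.CellFO

variable {L₁ L₂ : ℕ} [NeZero L₁] [NeZero L₂]

/-! ### Covariance transfers to the inverse -/

/-- **Covariance of the inverse**: if `A (σ p) (σ q) = τ_p τ_q A p q` for a bijection `σ` and signs `τ`, the same holds
for `A⁻¹`. -/
theorem inv_covariant {ι : Type} [Fintype ι] [DecidableEq ι] {A : Matrix ι ι ℂ} (hA : IsUnit A.det) (σ : ι ≃ ι)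
    (τ : ι → ℂ) (hτ : ∀ p, τ p * τ p = 1) (h : ∀ p q, A (σ p) (σ q) = τ p * τ q * A p q) (p q : ι) :
    A⁻¹ (σ p) (σ q) = τ p * τ q * A⁻¹ p q := by
  have hB : (Matrix.of fun p q => τ p * τ q * A⁻¹ (σ p) (σ q)) * A = 1 := by
    ext p q
    have hA' : ∀ r, A r q = τ r * τ q * A (σ r) (σ q) := fun r => by
      rw [h r q]
      linear_combination (-(A r q)) * hτ r + (-(τ r * τ r * A r q)) * hτ q
    simp only [Matrix.mul_apply, Matrix.of_apply]
    calc ∑ r, τ p * τ r * A⁻¹ (σ p) (σ r) * A r q = ∑ r, τ p * τ q * (A⁻¹ (σ p) (σ r) * A (σ r) (σ q)) := by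
          refine Finset.sum_congr rfl fun r _ => ?_
          rw [hA' r]
          linear_combination (τ p * τ q * A⁻¹ (σ p) (σ r) * A (σ r) (σ q)) * hτ r
      _ = τ p * τ q * (A⁻¹ * A) (σ p) (σ q) := by
          rw [Matrix.mul_apply, ← Equiv.sum_comp σ (fun r => A⁻¹ (σ p) r * A r (σ q)), Finset.mul_sum]
      _ = (1 : Matrix ι ι ℂ) p q := by
          rw [Matrix.nonsing_inv_mul _ hA]
          simp only [Matrix.one_apply, EmbeddingLike.apply_eq_iff_eq]
          by_cases hpq : p = q
          · subst hpq; simp [hτ]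
          · simp [hpq]
  have e := congrFun (congrFun (Matrix.inv_eq_left_inv hB) p) q
  simp only [Matrix.of_apply] at e
  rw [e]
  linear_combination (-(A⁻¹ (σ p) (σ q))) * hτ p + (-(τ p * τ p * A⁻¹ (σ p) (σ q))) * hτ q

/-! ### Covariance of the seam-signed shifts under the twisted translations -/

section Sites

/-- Translating the first coordinate: the identity site matrix. -/
theorem one_shift1 {R₁ R₂ : Type} [CommRing R₁] [DecidableEq R₁] [DecidableEq R₂] (a a' : R₁) (b b' : R₂) :
    (1 : Matrix (R₁ × R₂) (R₁ × R₂) ℂ) (a - 1, b) (a' - 1, b') =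
      (if a = 0 then (-1 : ℂ) else 1) * (if a' = 0 then (-1 : ℂ) else 1) * (1 : Matrix (R₁ × R₂) (R₁ × R₂) ℂ) (a, b) (a', b') := by
  simp only [Matrix.one_apply, Prod.mk.injEq, sub_left_inj]
  by_cases h : a = a' ∧ b = b'
  · obtain ⟨rfl, rfl⟩ := h
    simp only [and_self, if_true, mul_one]
    split_ifs <;> norm_num
  · simp [h]

/-- Translating the second coordinate: the identity site matrix. -/
theorem one_shift2 {R₁ R₂ : Type} [CommRing R₂] [DecidableEq R₁] [DecidableEq R₂] (a a' : R₁) (b b' : R₂) :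
    (1 : Matrix (R₁ × R₂) (R₁ × R₂) ℂ) (a, b - 1) (a', b' - 1) =
      (if b = 0 then (-1 : ℂ) else 1) * (if b' = 0 then (-1 : ℂ) else 1) * (1 : Matrix (R₁ × R₂) (R₁ × R₂) ℂ) (a, b) (a', b') := by
  simp only [Matrix.one_apply, Prod.mk.injEq, sub_left_inj]
  by_cases h : a = a' ∧ b = b'
  · obtain ⟨rfl, rfl⟩ := h
    simp only [and_self, if_true, mul_one]
    split_ifs <;> norm_num
  · simp [h]

/-- Translating the first coordinate: the forward first-coordinate shift picks up the twist. -/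
theorem fwd_shift1 {R₁ R₂ : Type} [CommRing R₁] [DecidableEq R₁] [DecidableEq R₂] (a a' : R₁) (b b' : R₂) :
    (if ((a' - 1, b') : R₁ × R₂) = (a - 1 + 1, b) then (if a - 1 = -1 then (-1 : ℂ) else 1) else 0) =
      (if a = 0 then (-1 : ℂ) else 1) * (if a' = 0 then (-1 : ℂ) else 1) *
        (if ((a', b') : R₁ × R₂) = (a + 1, b) then (if a = -1 then (-1 : ℂ) else 1) else 0) := by
  have h1 : (a' - 1 = a - 1 + 1) ↔ (a' = a + 1) := by constructor <;> intro h <;> linear_combination h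
  have h2 : (a - 1 = -1) ↔ (a = 0) := by constructor <;> intro h <;> linear_combination h
  simp only [Prod.mk.injEq, h1, h2]
  by_cases hab : a' = a + 1 ∧ b' = b
  · obtain ⟨rfl, rfl⟩ := hab
    have h3 : (a + 1 = 0) ↔ (a = -1) := by constructor <;> intro h <;> linear_combination h
    simp only [and_self, if_true, h3]
    split_ifs <;> norm_num
  · simp [hab]

/-- Translating the first coordinate: the forward second-coordinate shift is invariant. -/
theorem up_shift1 {R₁ R₂ : Type} [CommRing R₁] [CommRing R₂] [DecidableEq R₁] [DecidableEq R₂] (a a' : R₁) (b b' : R₂) :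
    (if ((a' - 1, b') : R₁ × R₂) = (a - 1, b + 1) then (if b = -1 then (-1 : ℂ) else 1) else 0) =
      (if a = 0 then (-1 : ℂ) else 1) * (if a' = 0 then (-1 : ℂ) else 1) *
        (if ((a', b') : R₁ × R₂) = (a, b + 1) then (if b = -1 then (-1 : ℂ) else 1) else 0) := by
  simp only [Prod.mk.injEq, sub_left_inj]
  by_cases hab : a' = a ∧ b' = b + 1
  · obtain ⟨rfl, rfl⟩ := hab
    simp only [and_self, if_true]
    split_ifs <;> norm_num
  · simp [hab]

/-- Translating the second coordinate: the forward second-coordinate shift picks up the twist. -/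
theorem up_shift2 {R₁ R₂ : Type} [CommRing R₂] [DecidableEq R₁] [DecidableEq R₂] (a a' : R₁) (b b' : R₂) :
    (if ((a', b' - 1) : R₁ × R₂) = (a, b - 1 + 1) then (if b - 1 = -1 then (-1 : ℂ) else 1) else 0) =
      (if b = 0 then (-1 : ℂ) else 1) * (if b' = 0 then (-1 : ℂ) else 1) *
        (if ((a', b') : R₁ × R₂) = (a, b + 1) then (if b = -1 then (-1 : ℂ) else 1) else 0) := by
  have h1 : (b' - 1 = b - 1 + 1) ↔ (b' = b + 1) := by constructor <;> intro h <;> linear_combination h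
  have h2 : (b - 1 = -1) ↔ (b = 0) := by constructor <;> intro h <;> linear_combination h
  simp only [Prod.mk.injEq, h1, h2]
  by_cases hab : a' = a ∧ b' = b + 1
  · obtain ⟨rfl, rfl⟩ := hab
    have h3 : (b + 1 = 0) ↔ (b = -1) := by constructor <;> intro h <;> linear_combination h
    simp only [and_self, if_true, h3]
    split_ifs <;> norm_num
  · simp [hab]

/-- Translating the second coordinate: the forward first-coordinate shift is invariant. -/
theorem fwd_shift2 {R₁ R₂ : Type} [CommRing R₁] [CommRing R₂] [DecidableEq R₁] [DecidableEq R₂] (a a' : R₁) (b b' : R₂) :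
    (if ((a', b' - 1) : R₁ × R₂) = (a + 1, b - 1) then (if a = -1 then (-1 : ℂ) else 1) else 0) =
      (if b = 0 then (-1 : ℂ) else 1) * (if b' = 0 then (-1 : ℂ) else 1) *
        (if ((a', b') : R₁ × R₂) = (a + 1, b) then (if a = -1 then (-1 : ℂ) else 1) else 0) := by
  simp only [Prod.mk.injEq, sub_left_inj]
  by_cases hab : a' = a + 1 ∧ b' = b
  · obtain ⟨rfl, rfl⟩ := hab
    simp only [and_self, if_true]
    split_ifs <;> norm_num
  · simp [hab]

end Sites

/-! ### Covariance of the free operator -/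

omit [NeZero L₁] [NeZero L₂] in
/-- Entries of the free operator in Kronecker form. -/
theorem free_apply (m ω₀ ω₁ : ℝ) (x y : ZMod L₁ × ZMod L₂) (c c' : Fin 3) (i j : Fin 4) :
    freeOp L₁ L₂ m ω₀ ω₁ (x, c, i) (y, c', j) =
      (1 : Matrix (ZMod L₁ × ZMod L₂) (ZMod L₁ × ZMod L₂) ℂ) x y * ((1 : Matrix (Fin 3) (Fin 3) ℂ) c c' * CellWalk.spinN (m + 4 - Real.cos ω₀ - Real.cos ω₁) (Real.sin ω₀) (Real.sin ω₁) i j) -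
      (sfShift L₁ L₂ x y * ((1 : Matrix (Fin 3) (Fin 3) ℂ) c c' * pMinus 2 i j) +
        sbShift L₁ L₂ x y * ((1 : Matrix (Fin 3) (Fin 3) ℂ) c c' * pPlus 2 i j) +
        ufShift L₁ L₂ x y * ((1 : Matrix (Fin 3) (Fin 3) ℂ) c c' * pMinus 3 i j) +
        ubShift L₁ L₂ x y * ((1 : Matrix (Fin 3) (Fin 3) ℂ) c c' * pPlus 3 i j)) := by
  rw [free_eq_kron, hopOp]
  simp only [Matrix.sub_apply, Matrix.add_apply, Matrix.kroneckerMap_apply]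

omit [NeZero L₁] [NeZero L₂] in
/-- **Twisted translation covariance (first coordinate)** of the free operator:
`D(x − e₁, y − e₁) = τ(x) τ(y) D(x, y)` with `τ = −1` on the column `x₁ = 0`. -/
theorem free_shift1 (m ω₀ ω₁ : ℝ) (p q : (ZMod L₁ × ZMod L₂) × Fin 3 × Fin 4) :
    freeOp L₁ L₂ m ω₀ ω₁ ((p.1.1 - 1, p.1.2), p.2) ((q.1.1 - 1, q.1.2), q.2) =
      (if p.1.1 = 0 then (-1 : ℂ) else 1) * (if q.1.1 = 0 then (-1 : ℂ) else 1) * freeOp L₁ L₂ m ω₀ ω₁ p q := by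
  obtain ⟨⟨a, b⟩, c, i⟩ := p
  obtain ⟨⟨a', b'⟩, c', j⟩ := q
  rw [free_apply, free_apply]
  simp only [sfShift, sbShift, ufShift, ubShift, Matrix.of_apply]
  rw [one_shift1 a a' b b', fwd_shift1 a a' b b', up_shift1 a a' b b', fwd_shift1 a' a b' b, up_shift1 a' a b' b]
  ring

omit [NeZero L₁] [NeZero L₂] in
/-- **Twisted translation covariance (second coordinate)** of the free operator. -/
theorem free_shift2 (m ω₀ ω₁ : ℝ) (p q : (ZMod L₁ × ZMod L₂) × Fin 3 × Fin 4) :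
    freeOp L₁ L₂ m ω₀ ω₁ ((p.1.1, p.1.2 - 1), p.2) ((q.1.1, q.1.2 - 1), q.2) =
      (if p.1.2 = 0 then (-1 : ℂ) else 1) * (if q.1.2 = 0 then (-1 : ℂ) else 1) * freeOp L₁ L₂ m ω₀ ω₁ p q := by
  obtain ⟨⟨a, b⟩, c, i⟩ := p
  obtain ⟨⟨a', b'⟩, c', j⟩ := q
  rw [free_apply, free_apply]
  simp only [sfShift, sbShift, ufShift, ubShift, Matrix.of_apply]
  rw [one_shift2 a a' b b', fwd_shift2 a a' b b', up_shift2 a a' b b', fwd_shift2 a' a b' b, up_shift2 a' a b' b]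
  ring

omit [NeZero L₁] [NeZero L₂] in
/-- **Colour rotation covariance** of the free operator. -/
theorem free_colourRot (m ω₀ ω₁ : ℝ) (p q : (ZMod L₁ × ZMod L₂) × Fin 3 × Fin 4) :
    freeOp L₁ L₂ m ω₀ ω₁ (p.1, finRotate 3 p.2.1, p.2.2) (q.1, finRotate 3 q.2.1, q.2.2) =
      (1 : ℂ) * 1 * freeOp L₁ L₂ m ω₀ ω₁ p q := by
  obtain ⟨x, c, i⟩ := p
  obtain ⟨y, c', j⟩ := q
  rw [free_apply, free_apply, one_mul, one_mul]
  simp only [Matrix.one_apply, (finRotate 3).apply_eq_iff_eq]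

omit [NeZero L₁] [NeZero L₂] in
/-- **Colour sign covariance** of the free operator (it is colour-diagonal). -/
theorem free_colourSign (m ω₀ ω₁ : ℝ) (c₀ : Fin 3) (p q : (ZMod L₁ × ZMod L₂) × Fin 3 × Fin 4) :
    freeOp L₁ L₂ m ω₀ ω₁ (Equiv.refl _ p) (Equiv.refl _ q) =
      (if p.2.1 = c₀ then (1 : ℂ) else -1) * (if q.2.1 = c₀ then (1 : ℂ) else -1) * freeOp L₁ L₂ m ω₀ ω₁ p q := by
  obtain ⟨x, c, i⟩ := p
  obtain ⟨y, c', j⟩ := q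
  rw [Equiv.refl_apply, Equiv.refl_apply, free_apply]
  by_cases hc : c = c'
  · subst hc
    have h : (if c = c₀ then (1 : ℂ) else -1) * (if c = c₀ then (1 : ℂ) else -1) = 1 := by split_ifs <;> norm_num
    rw [h, one_mul]
  · simp [Matrix.one_apply, hc]

/-! ### `γ₅`-hermiticity -/

omit [NeZero L₁] [NeZero L₂] in
/-- `γ₅ P₋^μ γ₅ = P₊^μ`. -/
theorem g5_pMinus_g5 (μ : Fin 4) : gammaFive * pMinus μ * gammaFive = pPlus μ := by
  rw [pMinus, pPlus, Matrix.mul_smul, Matrix.smul_mul, Matrix.mul_sub, Matrix.sub_mul, Matrix.mul_one, gammaFive_mul_self,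
    Matrix.mul_assoc, Summit.QuantumFields.QCD.Theorems.UnquenchedChessboardBoundLine.AxisSwap.euclideanGamma_mul_gammaFive_eq,
    Matrix.mul_neg, ← Matrix.mul_assoc, gammaFive_mul_self, Matrix.one_mul, sub_neg_eq_add]

omit [NeZero L₁] [NeZero L₂] in
/-- `γ₅ P₊^μ γ₅ = P₋^μ`. -/
theorem g5_pPlus_g5 (μ : Fin 4) : gammaFive * pPlus μ * gammaFive = pMinus μ := by
  rw [pMinus, pPlus, Matrix.mul_smul, Matrix.smul_mul, Matrix.mul_add, Matrix.add_mul, Matrix.mul_one, gammaFive_mul_self,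
    Matrix.mul_assoc, Summit.QuantumFields.QCD.Theorems.UnquenchedChessboardBoundLine.AxisSwap.euclideanGamma_mul_gammaFive_eq,
    Matrix.mul_neg, ← Matrix.mul_assoc, gammaFive_mul_self, Matrix.one_mul, ← sub_eq_add_neg]

omit [NeZero L₁] [NeZero L₂] in
/-- `γ₅ N_ω γ₅ = N_ωᴴ`. -/
theorem g5_nM_g5 (M s₀ s₁ : ℝ) : gammaFive * CellWalk.spinN M s₀ s₁ * gammaFive = (CellWalk.spinN M s₀ s₁)ᴴ := by
  have h0 := Summit.QuantumFields.QCD.Theorems.UnquenchedChessboardBoundLine.AxisSwap.euclideanGamma_mul_gammaFive_eq 0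
  have h1 := Summit.QuantumFields.QCD.Theorems.UnquenchedChessboardBoundLine.AxisSwap.euclideanGamma_mul_gammaFive_eq 1
  rw [nM_conjTranspose, CellWalk.spinN]
  simp only [Matrix.mul_add, Matrix.add_mul, Matrix.mul_smul, Matrix.smul_mul, Matrix.mul_one, gammaFive_mul_self,
    Matrix.mul_assoc, h0, h1, Matrix.mul_neg]
  simp only [← Matrix.mul_assoc, gammaFive_mul_self, Matrix.one_mul]
  module

/-- **`γ₅`-hermiticity of the free operator**: `Dᴴ = Γ₅ D Γ₅` with `Γ₅ = 1 ⊗ 1 ⊗ γ₅`. -/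
theorem free_conjTranspose (m ω₀ ω₁ : ℝ) :
    (freeOp L₁ L₂ m ω₀ ω₁)ᴴ =
      ((1 : Matrix (ZMod L₁ × ZMod L₂) (ZMod L₁ × ZMod L₂) ℂ) ⊗ₖ ((1 : Matrix (Fin 3) (Fin 3) ℂ) ⊗ₖ gammaFive)) *
        freeOp L₁ L₂ m ω₀ ω₁ *
      ((1 : Matrix (ZMod L₁ × ZMod L₂) (ZMod L₁ × ZMod L₂) ℂ) ⊗ₖ ((1 : Matrix (Fin 3) (Fin 3) ℂ) ⊗ₖ gammaFive)) := by
  rw [free_eq_kron, hopOp]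
  have hct := (g5_nM_g5 (m + 4 - Real.cos ω₀ - Real.cos ω₁) (Real.sin ω₀) (Real.sin ω₁)).symm
  simp only [Matrix.conjTranspose_sub, Matrix.conjTranspose_add, Matrix.conjTranspose_kronecker,
    Matrix.conjTranspose_one, Sf_conjTranspose, Sb_conjTranspose, Uf_conjTranspose, Ub_conjTranspose,
    CellWalk.conjTranspose_pMinus, CellWalk.conjTranspose_pPlus, Matrix.mul_sub, Matrix.sub_mul, Matrix.mul_add,
    Matrix.add_mul,
    ← Matrix.mul_kronecker_mul, Matrix.one_mul, Matrix.mul_one, g5_pMinus_g5, g5_pPlus_g5, hct]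
  abel

/-- `Γ₅ Γ₅ = 1`. -/
theorem G5_mul_G5 :
    ((1 : Matrix (ZMod L₁ × ZMod L₂) (ZMod L₁ × ZMod L₂) ℂ) ⊗ₖ ((1 : Matrix (Fin 3) (Fin 3) ℂ) ⊗ₖ gammaFive)) *
      ((1 : Matrix (ZMod L₁ × ZMod L₂) (ZMod L₁ × ZMod L₂) ℂ) ⊗ₖ ((1 : Matrix (Fin 3) (Fin 3) ℂ) ⊗ₖ gammaFive)) = 1 := by
  rw [← Matrix.mul_kronecker_mul, ← Matrix.mul_kronecker_mul, Matrix.one_mul, Matrix.one_mul, gammaFive_mul_self,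
    Matrix.one_kronecker_one, Matrix.one_kronecker_one]

omit [NeZero L₁] [NeZero L₂] in
/-- `Γ₅` is the diagonal sign matrix `p ↦ ε_{spin p}`. -/
theorem G5_eq_diagonal :
    ((1 : Matrix (ZMod L₁ × ZMod L₂) (ZMod L₁ × ZMod L₂) ℂ) ⊗ₖ ((1 : Matrix (Fin 3) (Fin 3) ℂ) ⊗ₖ gammaFive)) =
      Matrix.diagonal fun p : (ZMod L₁ × ZMod L₂) × Fin 3 × Fin 4 => (![1, 1, -1, -1] : Fin 4 → ℂ) p.2.2 := by
  rw [gammaFive_eq_diagonal, ← Matrix.diagonal_one, ← Matrix.diagonal_one, Matrix.diagonal_kronecker_diagonal,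
    Matrix.diagonal_kronecker_diagonal]
  congr 1
  funext p
  simp

/-- **`γ₅`-hermiticity of the free propagator**: `(D⁻¹)ᴴ = Γ₅ D⁻¹ Γ₅`. -/
theorem free_inv_conjTranspose {m ω₀ ω₁ : ℝ} (hM : 2 < m + 4 - Real.cos ω₀ - Real.cos ω₁) :
    ((freeOp L₁ L₂ m ω₀ ω₁)⁻¹)ᴴ =
      ((1 : Matrix (ZMod L₁ × ZMod L₂) (ZMod L₁ × ZMod L₂) ℂ) ⊗ₖ ((1 : Matrix (Fin 3) (Fin 3) ℂ) ⊗ₖ gammaFive)) *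
        (freeOp L₁ L₂ m ω₀ ω₁)⁻¹ *
      ((1 : Matrix (ZMod L₁ × ZMod L₂) (ZMod L₁ × ZMod L₂) ℂ) ⊗ₖ ((1 : Matrix (Fin 3) (Fin 3) ℂ) ⊗ₖ gammaFive)) := by
  rw [Matrix.conjTranspose_nonsing_inv, free_conjTranspose]
  refine Matrix.inv_eq_left_inv ?_
  have hGD : (freeOp L₁ L₂ m ω₀ ω₁)⁻¹ * freeOp L₁ L₂ m ω₀ ω₁ = 1 := Matrix.nonsing_inv_mul _ (free_isUnit_det hM)
  calc _ = ((1 : Matrix (ZMod L₁ × ZMod L₂) (ZMod L₁ × ZMod L₂) ℂ) ⊗ₖ ((1 : Matrix (Fin 3) (Fin 3) ℂ) ⊗ₖ gammaFive)) *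
        (freeOp L₁ L₂ m ω₀ ω₁)⁻¹ *
        (((1 : Matrix (ZMod L₁ × ZMod L₂) (ZMod L₁ × ZMod L₂) ℂ) ⊗ₖ ((1 : Matrix (Fin 3) (Fin 3) ℂ) ⊗ₖ gammaFive)) *
          ((1 : Matrix (ZMod L₁ × ZMod L₂) (ZMod L₁ × ZMod L₂) ℂ) ⊗ₖ ((1 : Matrix (Fin 3) (Fin 3) ℂ) ⊗ₖ gammaFive))) *
        freeOp L₁ L₂ m ω₀ ω₁ *
        ((1 : Matrix (ZMod L₁ × ZMod L₂) (ZMod L₁ × ZMod L₂) ℂ) ⊗ₖ ((1 : Matrix (Fin 3) (Fin 3) ℂ) ⊗ₖ gammaFive)) := by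
          simp only [Matrix.mul_assoc]
    _ = 1 := by rw [G5_mul_G5, Matrix.mul_one, Matrix.mul_assoc _ _ (freeOp L₁ L₂ m ω₀ ω₁), hGD, Matrix.mul_one,
          G5_mul_G5]

/-- **`γ₅`-hermiticity of the free propagator, entrywise**: `conj G(q, p) = ε_p ε_q G(p, q)`. -/
theorem free_inv_star {m ω₀ ω₁ : ℝ} (hM : 2 < m + 4 - Real.cos ω₀ - Real.cos ω₁)
    (p q : (ZMod L₁ × ZMod L₂) × Fin 3 × Fin 4) :
    star ((freeOp L₁ L₂ m ω₀ ω₁)⁻¹ q p) =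
      (![1, 1, -1, -1] : Fin 4 → ℂ) p.2.2 * (![1, 1, -1, -1] : Fin 4 → ℂ) q.2.2 * (freeOp L₁ L₂ m ω₀ ω₁)⁻¹ p q := by
  rw [← Matrix.conjTranspose_apply, free_inv_conjTranspose hM, G5_eq_diagonal, Matrix.mul_diagonal, Matrix.diagonal_mul]
  ring

end CellFO

/-- **Registered anchor `cellFreeShiftCovariance`**: twisted translation covariance of the free operator in the first coordinate. -/
theorem cellFreeShiftCovariance : ∀ (L₁ L₂ : ℕ) (m ω₀ ω₁ : ℝ) (p q : (ZMod L₁ × ZMod L₂) × Fin 3 × Fin 4), CellFO.freeOp L₁ L₂ m ω₀ ω₁ ((p.1.1 - 1, p.1.2), p.2) ((q.1.1 - 1, q.1.2), q.2) = (if p.1.1 = 0 then (-1 : ℂ) else 1) * (if q.1.1 = 0 then (-1 : ℂ) else 1) * CellFO.freeOp L₁ L₂ m ω₀ ω₁ p q :=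
  fun _ _ m ω₀ ω₁ p q => CellFO.free_shift1 m ω₀ ω₁ p q

end Summit.QuantumFields.QCD.Cruxes.CriticalLineDiamagnetism.ChessboardCellGain

end
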